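import Literature.Barriers.CriticalPhenomena.LaceExpansionPcInputs
import HarnessLib

/-!
# Hara's weighted diagrams `Ḡ^{(α)}, W̄^{(β,γ)}, T̄^{(β,γ)}, S̄^{(γ)}, H̄^{(β)}` at `p_c` and the
# three lemmas of the `x`-space analysis (Hara 2008, Lemmas 1.5, 1.6, 1.7) as named facts

Barrier catalogue `Literature/Barriers/CriticalPhenomena/` (D-0021), companion of
`LaceExpansionPcInputs.lean`, which split `Hara2008_laceExpansionPc` into the `k`-space half
`Hara2008_prop12Pc` and the `x`-space half `Hara2008_xSpacePiBoundPc`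
(`|Π_{p_c}(x)| ≤ c⟦x⟧^{-2(d-2)}`, `d ≥ 11`). This file vendors the inputs of Hara's printed proof
of the `x`-space half (Hara 2008, §1.2.3–§1.2.4): the two diagrammatic lemmas and the analytic
lemma, stated over the critical two-point function `G(a) = τ_{p_c}(0,a)` of bond percolation on
`ℤ^d` and a lace-expansion coefficient `Φ` (`IsLaceCoefficientPc d Φ`, unique by
`IsLaceCoefficientPc.unique`, so "for every such `Φ`" is the statement about the `Π_{p_c}` of
the sources). The reduction itself — the recursion of §1.2.4 and the two applications of
Lemma 1.5 around the Gaussian lemma — is PROVED in `LaceExpansionXSpaceBootstrap.lean`.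

## Contents

* Hara's weighted quantities (§1.1, (the displays defining `G^{(α)}, W^{(β,γ)}, T^{(β,γ)},
  S^{(γ)}, H^{(β)}` and their suprema "denoted by bars"), at `p = p_c`):
  `haraG d α a = |a|^α G(a)` and the suprema `haraGBar d α`, `haraWBar d β γ`, `haraTBar d β γ`,
  `haraSBar d γ`, `haraHBar d β` as elements of `[0, ∞]` (so that "is finite" is `< ⊤`; the sums
  are over `ℤ^d`, `ℤ^d × ℤ^d`, …; `haraHBar` is the diagram `H̄^{(β)}`, not a supremum of the
  integral `haraH` of `LaceExpansionXSpaceAsymptotics.lean`); `IsOddInt`;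
* NAMED FACTS (percolation parts, `d ≥ 11`, over `IsLaceCoefficientPc d Φ`):
  `Hara2008_lemma15Pc` (Lemma 1.5: `G ≤ β⟦x⟧^{-α}` gives `|Π(x)| ≤ cβ²⟦x⟧^{-2α}`),
  `Hara2008_lemma16Pc` (Lemma 1.6: `W̄^{(β,γ)}, T̄^{(0,γ)}, H̄^{(β)} < ∞` give
  `Σ_x |x|^{β+γ}|Π(x)| < ∞`), `Hara2008_lemma17Pc` (Lemma 1.7: `Σ_x |x|^φ |Π(x)| < ∞`, `φ ≥ 2`
  (printed: `φ > 1`, see "Scope of `φ`" below), gives the finiteness of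
  `Ḡ^{(α)}, W̄^{(β,γ)}, T̄^{(β,γ)}, S̄^{(γ)}, H̄^{(β)}` in the printed ranges of exponents);
* API: `le_of_haraGBar_lt_top` (a finite `Ḡ^{(α)}` is a pointwise bound `|a|^α G(a) ≤ C`).

Design. `T^{(β,γ)}(a)` and `S^{(γ)}(a)` are printed with the corrections
`- I[a = 0, β = γ = 0] G(0)³` and `- I[a = 0, γ = 0] G(0)⁴`; these change the values by at most
`1` and are irrelevant for the finiteness assertions of Lemmas 1.6–1.7, so they are omitted here
(they matter for the smallness `T̄^{(0,0)} < λ` of Prop. 1.2, which is not vendored). In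
`H^{(β)}(a,b)` the printed sum over `x, y, z, u, v` is indexed by `ℤ^d × ℤ^d × ℤ^d × ℤ^d × ℤ^d`.
The lemmas carry Hara's standing hypotheses "for which Proposition 1.2 holds" / "`λ`
sufficiently small": for `d ≥ 19` this is Prop. 1.2 (`λ ≤ c₃/d`), for `11 ≤ d ≤ 18` the
verification of "the conditions that Hara poses" by Fitzner–van der Hofstad 2017 (Thm. 1.4 and
§7), which is why the facts are restricted to `d ≥ 11` exactly as `Hara2008_xSpacePiBoundPc`.

Scope of `φ` in Lemma 1.7. Hara prints the moment hypothesis as "`Σ_x |x|^φ |Π(x)| < ∞` for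
some `φ > 1`". His proof uses two derivatives of `Ĵ` throughout — the parity step of the proof
of Lemma 4.1 (§4.2: `|∂_j^ℓ Ĵ(k)| ≤ sup_k |∂_j^{ℓ+1} Ĵ(k)| |k|` "for odd `ℓ` satisfying
`ℓ + 1 ≤ M`", applied with `ℓ = 1`) and the bounds `|ψ̂₁| ≤ c|k|^{-4}`, `|∂₁ψ̂₁| ≤ c|k|^{-5}` of
§4.4 ("By `Ĵ_{p_c}(0) = 1`, the estimate [`Σ_x |x|² |Π_p(x)| ≤ c/d`,
`c₁|k|²/d ≤ Ĵ_p(0) - Ĵ_p(k)` of Prop. 1.2], and the fact that `Ĵ(k)` is even in `k₁`") —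
which in print come from the standing bound `Σ_x |x|² |Π_p(x)| ≤ c/d` of Prop. 1.2, not from
`φ > 1`. Under that standing bound the lemma for `1 < φ < 2` IS the lemma for `φ = 2` (the set
of conclusions grows with `φ`), and every application (§1.2.4: `φ₀ = 2`, `φ_i` increasing;
`LaceExpansionXSpaceBootstrap.lean`) has `φ ≥ 2`. The fact is therefore vendored with `2 ≤ φ`
(review of the split, D-0026), matching the tree's Lemma 4.1
(`LaceExpansionHaraLemma41.lean`, hypothesis `2 ≤ M`, same scope note); `IsLaceCoefficientPc`
itself carries no moment of `Π` beyond summability.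

Status of the discharge of `Hara2008_lemma17Pc` (Hara's §4; proved pieces, none used in this
file): Lemma 4.1 — `LaceExpansionHaraLemma41.lean`
(`IsLaceCoefficientPc.exists_norm_sliceDeriv_le`); the identity
`|x_j|^{2n} G(x) (2π)^d = (-1)^n ∫ e^{ikx} ∂_j^{2n} Ĝ(k) dk` of §4.1.2 on the whole cube and the
integrability of `∂_j^m Ĝ` — `LaceExpansionHaraLemma41Cube.lean`; the `Ḡ`-clause for
`⌈α⌉ ≤ ⌊φ⌋`, `⌈α⌉ + 3 ≤ d` (§4.1.2–§4.1.3) — `LaceExpansionHaraLemma17G.lean`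
(`IsLaceCoefficientPc.haraGBar_lt_top_of_rpow`); the bound on the chain diagrams `W, T, S` by
`L^p`-norms of Fourier representatives, the rigorous form of their Fourier representations
(§4.1.1) and of "the first integral is finite if `4 + β + γ < d`" (§4.1.2) —
`LaceExpansionXSpaceNormsFejer.lean` (`HaraNorms.tsum_prod_le`). Not in the tree: the
`H̄`-clause (the `3d`-dimensional integral of §4.1.2, "finite by elementary power counting"),
the fractional exponents (§4.1.3 via Lemma 4.2; §4.3, Props. 4.3–4.5; Lemma 4.6) and §4.1.4
(`Ḡ^{(α)}` for `⌊φ⌋ < α ≤ φ`).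

## References

* T. Hara, Ann. Probab. 36 (2008) 530–593 (arXiv:math-ph/0504021): §1.1 (the weighted
  quantities `G^{(α)}, B, W^{(β,γ)}, T^{(β,γ)}, S^{(γ)}, P, H^{(β)}` and their suprema); §1.2
  ("only … for large `d` (say `d ≥ 30`) for percolation. Results for percolation in `d ≥ 19` can
  be obtained by more detailed diagrammatic estimates which slightly improve conditions in
  Lemmas 1.5 and 1.6"); Lemma 1.5 (§1.2.3), Lemma 1.6 and Lemma 1.7 (§1.2.4); §3.4–§3.5
  (proofs of the percolation parts of Lemmas 1.6, 1.5), §4 (proof of Lemma 1.7).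
* R. Fitzner, R. van der Hofstad, Electron. J. Probab. 22 (2017) no. 43: Thm. 1.4 and §7 ("The
  proof of Theorem 1.4 follows by verifying that the conditions that Hara poses in [Hara08] …
  are satisfied"), §2.6.
* M. Heydenreich, R. van der Hofstad, *Progress in High-Dimensional Percolation and Random
  Graphs*, Springer 2017: (11.2.5)–(11.2.9) and (11.2.13), p. 139.
-/

noncomputable section

namespace Literature.Barriers.CriticalPhenomena

open _root_.MeasureTheory _root_.Filter Literature.Probability.LatticeModels
  Literature.Probability.Percolation

open scoped ENNReal

variable {d : ℕ}

/-! ### Hara's weighted quantities at `p = p_c` -/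

/-- `G^{(α)}(a) := |a|^α G(a)` with `G(a) = τ_{p_c}(0,a)` the critical two-point function and `|a|`
the Euclidean norm (`|0|^0 = 1`). [cite: Hara2008, §1.1 (definition of G^{(α)})] -/
def haraG (d : ℕ) (α : ℝ) (a : Site d) : ℝ := euclidNorm a ^ α * tau d (criticalProbI d) 0 a

/-- `G^{(α)} ≥ 0`. [folklore] -/
theorem haraG_nonneg (d : ℕ) (α : ℝ) (a : Site d) : 0 ≤ haraG d α a :=
  mul_nonneg (Real.rpow_nonneg (euclidNorm_nonneg a) α) (tau_nonneg _ _ _)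

/-- `G^{(0)} = G`. [folklore] -/
@[simp] theorem haraG_zero (d : ℕ) (a : Site d) : haraG d 0 a = tau d (criticalProbI d) 0 a := by
  simp [haraG]

/-- `Ḡ^{(α)} := sup_a |a|^α G(a) ∈ [0, ∞]`. [cite: Hara2008, §1.1 (suprema "denoted by bars")] -/
def haraGBar (d : ℕ) (α : ℝ) : ℝ≥0∞ := ⨆ a : Site d, ENNReal.ofReal (haraG d α a)

/-- `W̄^{(β,γ)} := sup_a Σ_y G^{(β)}(y) G^{(γ)}(a - y) ∈ [0, ∞]` (`W^{(β,γ)} = G^{(β)} ⋆ G^{(γ)}`).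
[cite: Hara2008, §1.1 (definition of W^{(β,γ)} and its supremum)] -/
def haraWBar (d : ℕ) (β γ : ℝ) : ℝ≥0∞ :=
  ⨆ a : Site d, ∑' y : Site d, ENNReal.ofReal (haraG d β y * haraG d γ (a - y))

/-- `T̄^{(β,γ)} := sup_a Σ_{x,y} G^{(β)}(x) G^{(γ)}(y - x) G(a - y) ∈ [0, ∞]`
(`T^{(β,γ)} = G^{(β)} ⋆ G^{(γ)} ⋆ G`; the printed correction `- I[a = 0, β = γ = 0] G(0)³`, at
most `1`, is omitted — it does not affect finiteness).
[cite: Hara2008, §1.1 (definition of T^{(β,γ)} and its supremum)] -/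
def haraTBar (d : ℕ) (β γ : ℝ) : ℝ≥0∞ :=
  ⨆ a : Site d, ∑' xy : Site d × Site d,
    ENNReal.ofReal (haraG d β xy.1 * haraG d γ (xy.2 - xy.1) * tau d (criticalProbI d) 0 (a - xy.2))

/-- `S̄^{(γ)} := sup_a Σ_{x,y,z} G^{(γ)}(x) G(y - x) G(z - y) G(a - z) ∈ [0, ∞]`
(`S^{(γ)} = G^{(γ)} ⋆ G ⋆ G ⋆ G`; the printed correction `- I[a = 0, γ = 0] G(0)⁴` is omitted).
[cite: Hara2008, §1.1 (definition of S^{(γ)} and its supremum)] -/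
def haraSBar (d : ℕ) (γ : ℝ) : ℝ≥0∞ :=
  ⨆ a : Site d, ∑' xyz : Site d × Site d × Site d,
    ENNReal.ofReal (haraG d γ xyz.1 * tau d (criticalProbI d) 0 (xyz.2.1 - xyz.1) *
      tau d (criticalProbI d) 0 (xyz.2.2 - xyz.2.1) * tau d (criticalProbI d) 0 (a - xyz.2.2))

/-- `H̄^{(β)} := sup_{a,b} Σ_{x,y,z,u,v} G(z) G(u) G(x-u) G^{(β)}(x) G(y-x) G(v-u) G(z+a-v) G(y+b-v)
∈ [0, ∞]`. [cite: Hara2008, §1.1 (definition of H^{(β)}(a,b) and its supremum)] -/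
def haraHBar (d : ℕ) (β : ℝ) : ℝ≥0∞ :=
  ⨆ ab : Site d × Site d, ∑' s : Site d × Site d × Site d × Site d × Site d,
    ENNReal.ofReal (tau d (criticalProbI d) 0 s.2.2.1 * tau d (criticalProbI d) 0 s.2.2.2.1 *
      tau d (criticalProbI d) 0 (s.1 - s.2.2.2.1) * haraG d β s.1 *
      tau d (criticalProbI d) 0 (s.2.1 - s.1) * tau d (criticalProbI d) 0 (s.2.2.2.2 - s.2.2.2.1) *
      tau d (criticalProbI d) 0 (s.2.2.1 + ab.1 - s.2.2.2.2) *
      tau d (criticalProbI d) 0 (s.2.1 + ab.2 - s.2.2.2.2))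

/-- `x` is an odd integer (`x = 2n + 1`, `n ∈ ℤ`): the exponents excluded in Lemma 1.7 ("for
nonnegative `α, β, γ` which are not odd integers"). [cite: Hara2008, Lemma 1.7] -/
def IsOddInt (x : ℝ) : Prop := ∃ n : ℤ, x = 2 * n + 1

/-- **A finite `Ḡ^{(α)}` is a pointwise bound**: `Ḡ^{(α)} < ∞` gives `C` with `|a|^α G(a) ≤ C`
for all `a`. [folklore] -/
theorem le_of_haraGBar_lt_top {α : ℝ} (h : haraGBar d α < ⊤) :
    ∃ C : ℝ, ∀ a : Site d, haraG d α a ≤ C := by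
  refine ⟨(haraGBar d α).toReal, fun a => ?_⟩
  have hle : ENNReal.ofReal (haraG d α a) ≤ haraGBar d α :=
    le_iSup (fun a => ENNReal.ofReal (haraG d α a)) a
  exact (ENNReal.ofReal_le_iff_le_toReal h.ne).1 hle

/-- Conversely a pointwise bound gives `Ḡ^{(α)} < ∞`. [folklore] -/
theorem haraGBar_lt_top_of_le {α C : ℝ} (h : ∀ a : Site d, haraG d α a ≤ C) : haraGBar d α < ⊤ := by
  refine lt_of_le_of_lt (iSup_le fun a => ENNReal.ofReal_le_ofReal (h a)) ENNReal.ofReal_lt_top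

/-! ### The three lemmas of Hara's `x`-space analysis, percolation parts, as named facts -/

/-- NAMED FACT — **Hara 2008, Lemma 1.5 (percolation)**: "Consider SAW, percolation, or LTLA for
which Proposition 1.2 holds. Suppose we have a bound `G(x) ≤ β ⟦x⟧^{-α}` with `β > 0` and
`0 < α < d`. Then for `x ≠ 0`, `|Π(x)| ≤ c β² ⟦x⟧^{-2α}` (percolation in `d > 8` with `λ ≪ 1`)
with a `λ`-dependent constant `c`" (proved in §3.5; "The restriction `d > 8` (for percolation)
… is present for technical reasons"). Here `G = τ_{p_c}(0,·)`, `Π = Φ` with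
`IsLaceCoefficientPc d Φ` (unique), `d ≥ 11` (where the standing hypotheses are in print:
Prop. 1.2 for `d ≥ 19`, Fitzner–van der Hofstad 2017, Thm. 1.4/§7 for `d ≥ 11`); the constant
may depend on `d` and `α` but not on `β`. Users take `(h : Hara2008_lemma15Pc)`.
[cite: Hara2008, Lemma 1.5 (percolation case) and §3.5]
[cite: FitznerVanDerHofstad2017, Thm. 1.4 and §7] -/
def Hara2008_lemma15Pc : Prop :=
  ∀ (d : ℕ), 11 ≤ d → ∀ Φ : Site d → ℝ, IsLaceCoefficientPc d Φ →
    ∀ α : ℝ, 0 < α → α < d → ∃ c : ℝ, ∀ β : ℝ, 0 < β →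
      (∀ x : Site d, tau d (criticalProbI d) 0 x ≤ β / jnorm x ^ α) →
        ∀ x : Site d, x ≠ 0 → |Φ x| ≤ c * β ^ 2 / jnorm x ^ (2 * α)

/-- NAMED FACT — **Hara 2008, Lemma 1.6 (percolation)**: "For percolation with `λ` sufficiently
small, suppose `W̄^{(β,γ)}`, `T̄^{(0,γ)}` and `H̄^{(β)}` are finite for some `β, γ ≥ 0`. Then
`Σ_x |x|^{β+γ} |Π(x)| < ∞`" (proved in §3.4). Same conventions and scope as
`Hara2008_lemma15Pc`. Users take `(h : Hara2008_lemma16Pc)`.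
[cite: Hara2008, Lemma 1.6 (percolation case) and §3.4]
[cite: FitznerVanDerHofstad2017, Thm. 1.4 and §7] -/
def Hara2008_lemma16Pc : Prop :=
  ∀ (d : ℕ), 11 ≤ d → ∀ Φ : Site d → ℝ, IsLaceCoefficientPc d Φ →
    ∀ β γ : ℝ, 0 ≤ β → 0 ≤ γ → haraWBar d β γ < ⊤ → haraTBar d 0 γ < ⊤ → haraHBar d β < ⊤ →
      Summable fun x : Site d => euclidNorm x ^ (β + γ) * |Φ x|

/-- NAMED FACT — **Hara 2008, Lemma 1.7**: "Suppose we have the expression of `G` in terms of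
the lace expansion. Suppose further `Σ_x |x|^φ |Π(x)| < ∞` for some `φ > 1`. Then, we have for
nonnegative `α, β, γ` which are not odd integers: `Ḡ^{(α)} < ∞` if `α ≤ φ` and `α < d - 2`;
`W̄^{(β,γ)} < ∞` if `β, γ ≤ ⌊φ⌋`, `β + γ < d - 4` and `β + γ - (⌊β⌋ + ⌊γ⌋) < 1`;
`T̄^{(β,γ)} < ∞` if `β, γ ≤ ⌊φ⌋`, `β + γ < d - 6` and `β + γ - (⌊β⌋ + ⌊γ⌋) < 1`;
`S̄^{(γ)} < ∞` if `γ ≤ ⌊φ⌋` and `γ < d - 8`; `H̄^{(β)} < ∞` if `β ≤ ⌊φ⌋`, `β < d - 4`, and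
`d > 6`" (pure Fourier analysis, §4). Same conventions and scope as `Hara2008_lemma15Pc`
(at `p = p_c`, `d ≥ 11`, where the representation and the `k`-space bounds its proof uses are
in print: Prop. 1.2, resp. Fitzner–van der Hofstad 2017, Thm. 1.1 and §2.6). Vendored with
`2 ≤ φ` in place of the printed `φ > 1`: the proof (§4.2, the parity step of Lemma 4.1; §4.4)
uses two derivatives of `Ĵ`, in print supplied by the standing bound `Σ_x |x|² |Π_p(x)| ≤ c/d`
of Prop. 1.2, under which the case `1 < φ < 2` is the case `φ = 2` (the conclusions are monotone
in `φ`); all applications in §1.2.4 have `φ ≥ φ₀ = 2` — see the module docstring, "Scope of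
`φ`". Users take `(h : Hara2008_lemma17Pc)`.
[cite: Hara2008, Lemma 1.7 and §4]
[cite: FitznerVanDerHofstad2017, Thm. 1.1, §2.6 and §7] -/
def Hara2008_lemma17Pc : Prop :=
  ∀ (d : ℕ), 11 ≤ d → ∀ Φ : Site d → ℝ, IsLaceCoefficientPc d Φ →
    ∀ φ : ℝ, 2 ≤ φ → (Summable fun x : Site d => euclidNorm x ^ φ * |Φ x|) →
      (∀ α : ℝ, 0 ≤ α → ¬ IsOddInt α → α ≤ φ → α < (d : ℝ) - 2 → haraGBar d α < ⊤) ∧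
      (∀ β γ : ℝ, 0 ≤ β → 0 ≤ γ → ¬ IsOddInt β → ¬ IsOddInt γ →
        β ≤ (⌊φ⌋ : ℝ) → γ ≤ (⌊φ⌋ : ℝ) → β + γ < (d : ℝ) - 4 →
        β + γ - ((⌊β⌋ : ℝ) + (⌊γ⌋ : ℝ)) < 1 → haraWBar d β γ < ⊤) ∧
      (∀ β γ : ℝ, 0 ≤ β → 0 ≤ γ → ¬ IsOddInt β → ¬ IsOddInt γ →
        β ≤ (⌊φ⌋ : ℝ) → γ ≤ (⌊φ⌋ : ℝ) → β + γ < (d : ℝ) - 6 →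
        β + γ - ((⌊β⌋ : ℝ) + (⌊γ⌋ : ℝ)) < 1 → haraTBar d β γ < ⊤) ∧
      (∀ γ : ℝ, 0 ≤ γ → ¬ IsOddInt γ → γ ≤ (⌊φ⌋ : ℝ) → γ < (d : ℝ) - 8 → haraSBar d γ < ⊤) ∧
      (∀ β : ℝ, 0 ≤ β → ¬ IsOddInt β → β ≤ (⌊φ⌋ : ℝ) → β < (d : ℝ) - 4 → 6 < d → haraHBar d β < ⊤)

end Literature.Barriers.CriticalPhenomena
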